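import Summits.Ventures.PercRepro.MergeKernel

/-!
# PercRepro — the coarse type vectors and the §2 sign table (typer-2, gen 3)

`LEAD-C011-concavity.md` §2, the algebra half of the type identity, part 2: `rowClosed`,
`rowOpened` (the rows of `ω[g := 0]`, `ω[g := 1]`), the special rows `xRow`, `r1Row`, `r2Row`,
`threeOneRows`, `coarseMerge` (the coarse merge vector of a configuration), the five coarse move
vectors `vA, vB, vC, vD, vE` (`⊥ → R_i`, `R_i → x_i`, `R_i → 3|1`, `x_i → ⊤`, `3|1 → ⊤`),
**`coarseForm_typeSum`** — the §2 sign table as an identity of the coarse form (pure algebra) —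
and the bilinearity of the coarse form over finite sums (`coarseForm_sum_sum`).
-/

namespace PercRepro

open Finset

/-! ### Rows before and after opening `g` -/

namespace MultiGraph

variable {V E : Type*} (G : MultiGraph V E) [Fintype E] [DecidableEq E]

/-- The row of `ω[g := false]` (the configuration of `G − g`). -/
noncomputable def rowClosed (g : E) (m : Fin 4 → V) (ω : Config E) : Fin 15 :=
  row4 (G.markedPartition (Function.update ω g false) m)

/-- The row of `ω[g := true]` (after opening `g`). -/
noncomputable def rowOpened (g : E) (m : Fin 4 → V) (ω : Config E) : Fin 15 :=
  row4 (G.markedPartition (Function.update ω g true) m)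

omit [Fintype E] in
/-- The merge vector is the difference of the basis vectors of the two rows. -/
theorem mergeVec_eq (g : E) (m : Fin 4 → V) (ω : Config E) :
    G.mergeVecM g m ω = fun s => rowVec (G.rowOpened g m ω) s - rowVec (G.rowClosed g m ω) s := by
  funext s
  rfl

/-- The crossing rows `x₀, x₁, x₂ = 3, 6, 8`. -/
def xRow : Fin 3 → Fin 15 := ![3, 6, 8]

/-- The first rank-1 row below `x_i`: `4, 7, 11`. -/
def r1Row : Fin 3 → Fin 15 := ![4, 7, 11]

/-- The second rank-1 row below `x_i`: `13, 12, 10`. -/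
def r2Row : Fin 3 → Fin 15 := ![13, 12, 10]

/-- The `3|1` rows `1, 2, 5, 9`. -/
def threeOneRows : Finset (Fin 15) := {1, 2, 5, 9}

/-! ### The coarse type vectors and the pointwise decomposition -/

/-- The coarse merge vector of a configuration. -/
noncomputable def coarseMerge (g : E) (m : Fin 4 → V) (ω : Config E) : Fin 9 → ℝ :=
  fun c => cVec (coarseOf (G.rowOpened g m ω)) c - cVec (coarseOf (G.rowClosed g m ω)) c

omit [Fintype E] in
/-- The coarse vector of the merge vector is the coarse merge vector. -/
theorem coarseVec_mergeVec (g : E) (m : Fin 4 → V) (ω : Config E) :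
    coarseVec (G.mergeVecM g m ω) = G.coarseMerge g m ω := by
  rw [mergeVec_eq, coarseVec_sub_rowVec]
  rfl

end MultiGraph

/-- The coarse cell of the crossing row `x_i`. -/
def cX : Fin 3 → Fin 9 := ![1, 2, 3]

/-- The coarse cell of the rank-1 rows below `x_i`. -/
def cR : Fin 3 → Fin 9 := ![4, 5, 6]

/-- The coarse move vectors of the five types: `A_i : ⊥ → R_i`, `B_i : R_i → x_i`, `C_i : R_i → 3|1`,
`D_i : x_i → ⊤`, `E : 3|1 → ⊤` (coarse cells `0 = ⊤`, `cX i = x_i`, `cR i = R_i`, `7 = ⊥`, `8 = 3|1`). -/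
def vA (i : Fin 3) : Fin 9 → ℝ := fun c => cVec (cR i) c - cVec 7 c

/-- The move vector of `B_i`. -/
def vB (i : Fin 3) : Fin 9 → ℝ := fun c => cVec (cX i) c - cVec (cR i) c

/-- The move vector of `C_i`. -/
def vC (i : Fin 3) : Fin 9 → ℝ := fun c => cVec 8 c - cVec (cR i) c

/-- The move vector of `D_i`. -/
def vD (i : Fin 3) : Fin 9 → ℝ := fun c => cVec 0 c - cVec (cX i) c

/-- The move vector of `E`. -/
def vE : Fin 9 → ℝ := fun c => cVec 0 c - cVec 8 c

/-- The coarse cells of the special rows. -/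
theorem coarseOf_r1Row : ∀ i, coarseOf (MultiGraph.r1Row i) = cR i := by decide

/-- The coarse cells of the special rows. -/
theorem coarseOf_r2Row : ∀ i, coarseOf (MultiGraph.r2Row i) = cR i := by decide

/-- The coarse cells of the special rows. -/
theorem coarseOf_xRow : ∀ i, coarseOf (MultiGraph.xRow i) = cX i := by decide

/-- The coarse cells of the special rows. -/
theorem coarseOf_threeOne : ∀ s ∈ MultiGraph.threeOneRows, coarseOf s = 8 := by decide

/-- The coarse cell of `⊥`. -/
theorem coarseOf_bot : coarseOf 14 = 7 := by decide

/-- The coarse cell of `⊤`. -/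
theorem coarseOf_top : coarseOf 0 = 0 := by decide

/-- **The algebraic core of the type identity**: the coarse form of two type combinations is the
§2 sign table, unsymmetrised (`τ` for the first copy, `τ′` for the second):
`½ Σ_{i≠j} B_iB′_j + ½ Σ_{i≠j} (B_iC′_j + C_iB′_j) − ½ Σ_{i≠j} (A_iB′_j + B_iA′_j) − ½ Σ_i (A_iD′_i + D_iA′_i)
− ½ A·E′ − ½ E·A′ − ½ Σ_{i≠j} (C_iD′_j + D_iC′_j) − ½ Σ_{i≠j} D_iD′_j` (pure algebra). -/
theorem coarseForm_typeSum (τA τB τC τD : Fin 3 → ℝ) (τE : ℝ) (τA' τB' τC' τD' : Fin 3 → ℝ)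
    (τE' : ℝ) :
    coarseForm
      (fun c => (∑ i, τA i * vA i c) + (∑ i, τB i * vB i c) + (∑ i, τC i * vC i c) +
        (∑ i, τD i * vD i c) + τE * vE c)
      (fun c => (∑ i, τA' i * vA i c) + (∑ i, τB' i * vB i c) + (∑ i, τC' i * vC i c) +
        (∑ i, τD' i * vD i c) + τE' * vE c) =
    (1 / 2 : ℝ) * ((∑ i, ∑ j, if i ≠ j then τB i * τB' j else 0) +
      (∑ i, ∑ j, if i ≠ j then τB i * τC' j + τC i * τB' j else 0) -
      (∑ i, ∑ j, if i ≠ j then τA i * τB' j + τB i * τA' j else 0) -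
      (∑ i, (τA i * τD' i + τD i * τA' i)) - (∑ i, τA i) * τE' - τE * (∑ i, τA' i) -
      (∑ i, ∑ j, if i ≠ j then τC i * τD' j + τD i * τC' j else 0) -
      (∑ i, ∑ j, if i ≠ j then τD i * τD' j else 0)) := by
  simp only [coarseForm, vA, vB, vC, vD, vE, cVec, cX, cR, kcoarse, Fin.sum_univ_succ,
    Fin.sum_univ_zero]
  simp
  ring

/-! ### Bilinearity of the coarse form over finite sums -/

/-- The coarse form is linear in its first argument over finite sums. -/
theorem coarseForm_sum_left {ι : Type*} (S : Finset ι) (c : ι → ℝ) (u : ι → Fin 9 → ℝ)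
    (v : Fin 9 → ℝ) :
    coarseForm (fun r => ∑ ω ∈ S, c ω * u ω r) v = ∑ ω ∈ S, c ω * coarseForm (u ω) v := by
  simp only [coarseForm]
  have step : ∀ s t : Fin 9, (kcoarse s t : ℝ) * (∑ ω ∈ S, c ω * u ω s) * v t =
      ∑ ω ∈ S, c ω * ((kcoarse s t : ℝ) * u ω s * v t) := by
    intro s t
    rw [Finset.mul_sum, Finset.sum_mul]
    exact Finset.sum_congr rfl fun ω _ => by ring
  simp only [step]
  have key : ∑ s : Fin 9, ∑ t : Fin 9, ∑ ω ∈ S, c ω * ((kcoarse s t : ℝ) * u ω s * v t) =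
      ∑ ω ∈ S, c ω * ∑ s : Fin 9, ∑ t : Fin 9, (kcoarse s t : ℝ) * u ω s * v t := by
    calc ∑ s : Fin 9, ∑ t : Fin 9, ∑ ω ∈ S, c ω * ((kcoarse s t : ℝ) * u ω s * v t)
        = ∑ s : Fin 9, ∑ ω ∈ S, ∑ t : Fin 9, c ω * ((kcoarse s t : ℝ) * u ω s * v t) :=
          Finset.sum_congr rfl fun s _ => Finset.sum_comm
      _ = ∑ ω ∈ S, ∑ s : Fin 9, ∑ t : Fin 9, c ω * ((kcoarse s t : ℝ) * u ω s * v t) :=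
          Finset.sum_comm
      _ = ∑ ω ∈ S, c ω * ∑ s : Fin 9, ∑ t : Fin 9, (kcoarse s t : ℝ) * u ω s * v t := by
          simp only [Finset.mul_sum]
  rw [key, Finset.mul_sum]
  refine Finset.sum_congr rfl fun ω _ => ?_
  ring

/-- The coarse form is linear in its second argument over finite sums. -/
theorem coarseForm_sum_right {ι : Type*} (S : Finset ι) (c : ι → ℝ) (u : Fin 9 → ℝ)
    (v : ι → Fin 9 → ℝ) :
    coarseForm u (fun r => ∑ ω ∈ S, c ω * v ω r) = ∑ ω ∈ S, c ω * coarseForm u (v ω) := by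
  simp only [coarseForm]
  have step : ∀ s t : Fin 9, (kcoarse s t : ℝ) * u s * (∑ ω ∈ S, c ω * v ω t) =
      ∑ ω ∈ S, c ω * ((kcoarse s t : ℝ) * u s * v ω t) := by
    intro s t
    rw [Finset.mul_sum]
    exact Finset.sum_congr rfl fun ω _ => by ring
  simp only [step]
  have key : ∑ s : Fin 9, ∑ t : Fin 9, ∑ ω ∈ S, c ω * ((kcoarse s t : ℝ) * u s * v ω t) =
      ∑ ω ∈ S, c ω * ∑ s : Fin 9, ∑ t : Fin 9, (kcoarse s t : ℝ) * u s * v ω t := by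
    calc ∑ s : Fin 9, ∑ t : Fin 9, ∑ ω ∈ S, c ω * ((kcoarse s t : ℝ) * u s * v ω t)
        = ∑ s : Fin 9, ∑ ω ∈ S, ∑ t : Fin 9, c ω * ((kcoarse s t : ℝ) * u s * v ω t) :=
          Finset.sum_congr rfl fun s _ => Finset.sum_comm
      _ = ∑ ω ∈ S, ∑ s : Fin 9, ∑ t : Fin 9, c ω * ((kcoarse s t : ℝ) * u s * v ω t) :=
          Finset.sum_comm
      _ = ∑ ω ∈ S, c ω * ∑ s : Fin 9, ∑ t : Fin 9, (kcoarse s t : ℝ) * u s * v ω t := by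
          simp only [Finset.mul_sum]
  rw [key, Finset.mul_sum]
  refine Finset.sum_congr rfl fun ω _ => ?_
  ring

/-- **The coarse form is bilinear over finite sums.** -/
theorem coarseForm_sum_sum {ι : Type*} (S : Finset ι) (c : ι → ℝ) (u : ι → Fin 9 → ℝ) :
    ∑ ω ∈ S, ∑ ω' ∈ S, c ω * c ω' * coarseForm (u ω) (u ω') =
      coarseForm (fun r => ∑ ω ∈ S, c ω * u ω r) (fun r => ∑ ω ∈ S, c ω * u ω r) := by
  rw [coarseForm_sum_left]
  simp only [coarseForm_sum_right, Finset.mul_sum]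
  refine Finset.sum_congr rfl fun ω _ => Finset.sum_congr rfl fun ω' _ => ?_
  ring

end PercRepro
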